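import Summits.BirchSwinnertonDyer.BirchSwinnertonDyer.Theorems.Rank2ObservatoryThreeIsoRowsD
import Summits.BirchSwinnertonDyer.BirchSwinnertonDyer.Theorems.Rank2ObservatoryThreeIsoRowsE
import Summits.BirchSwinnertonDyer.BirchSwinnertonDyer.Theorems.Rank2ObservatoryThreeIsoRowsF
import Summits.BirchSwinnertonDyer.BirchSwinnertonDyer.Theorems.Rank2ObservatoryThreeIsoRowsG
import Summits.BirchSwinnertonDyer.BirchSwinnertonDyer.Theorems.Rank2ObservatoryThreeIsoRowsH
import Summits.BirchSwinnertonDyer.BirchSwinnertonDyer.Theorems.Rank2ObservatoryThreeIsoRowsI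
import Summits.BirchSwinnertonDyer.BirchSwinnertonDyer.Theorems.Rank2ObservatoryThreeIsoRowsJ
import Summits.BirchSwinnertonDyer.BirchSwinnertonDyer.Theorems.Rank2ObservatoryThreeIsoRowsK
import Summits.BirchSwinnertonDyer.BirchSwinnertonDyer.Theorems.Rank2ObservatoryThreeIsoRowsL
import Summits.BirchSwinnertonDyer.BirchSwinnertonDyer.Theorems.Rank2ObservatoryThreeIsoRowsM
import Summits.BirchSwinnertonDyer.BirchSwinnertonDyer.Theorems.Rank2ObservatoryThreeIsoRowsN
import HarnessLib

/-!
# BirchSwinnertonDyer — rank ≥ 2 observatory: KERNEL-3ISO census, second part (1570 curves of the `ℤ/3` stratum with `rank_ℤ = 2` hypothesis-free)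

HONEST FRAMING: per-curve certified theorems and census instruments; no claim on BSD in rank ≥ 2.

`threeIsoRows2` = the 1570 rows of Cremona's rank-2 table (conductors `1862 … 256802`, labels `1862a1 … 256802a1`) with
`E(ℚ)_tors = ℤ/3` whose `3`-isogeny descent is closed by local kills of the E-side torsors `u X³ + Y³ + 2su Z³ − 2mu XYZ`
over `ℚ_p` and/or of the Ê-side torsors over `K = ℚ(ζ₃)` (restriction of scalars, Cohen–Pazuki Thm. 4.1), in cert-1 gen 10 by
the log rule `#S < 3^(a+1)`, `#S' < 3^(a'+1)`, `a + a' ≤ 3` (`Rank2ObservatoryThreeIsoIndexLog`) with kernel-checked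
certificate lists (`Rank2ObservatoryThreeIsoCertE`, `Rank2ObservatoryThreeIsoCertK`). Together with the 435 rows of
`Rank2ObservatoryThreeIsoCensus.lean` this extends the coverage of the `ℤ/3` stratum rows carrying a
feasibility certificate in the `k3iso` census. For EVERY row of `threeIsoRows2` both rank fields of the census are kernel
theorems (`forall_mem_threeIsoRows2_rank_eq_two`: `rank_ℤ E(ℚ) = 2` with NO hypothesis), hence `L(E,1) = L′(E,1) = 0` from
`hGZK` alone and `r_an = rank_ℤ = 2` from `hGZK` + `hL2`. This file only concatenates the lists of
`Rank2ObservatoryThreeIsoRowsD|E|F|G|H|I|J|K|L|M|N` (per-row chunk files `Rows030 … 134` underneath); no new mathematical content;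
axioms standard.
References: J. E. Cremona, *Algorithms for Modular Elliptic Curves* (2nd ed. 1997), Table 1, §2.13; H. Cohen, *Number Theory I*
(GTM 239), Prop. 8.4.8; H. Cohen, F. Pazuki, Acta Arith. 140 (2009), Prop. 2.2, Thm. 3.1, Thm. 4.1; H. Darmon (2004), Thm. 3.22.
-/

namespace Summit.BirchSwinnertonDyer.BirchSwinnertonDyer.Rank2Observatory

open WeierstrassCurve Literature.NumberTheory.EllipticCurves Literature.NumberTheory.EllipticCurves.MordellDescent

/-- **The KERNEL-3ISO census list, second part**: all 1570 rows (conductor-ascending). DATA. [cite: CremonaAlgorithms1997, Table 1] -/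
def threeIsoRows2 : List Rank2Row :=
  threeIsoRowsD ++ threeIsoRowsE ++ threeIsoRowsF ++ threeIsoRowsG ++ threeIsoRowsH ++ threeIsoRowsI ++
    threeIsoRowsJ ++ threeIsoRowsK ++ threeIsoRowsL ++ threeIsoRowsM ++ threeIsoRowsN

/-- `threeIsoRows2` has `1570` rows. [folklore] -/
theorem threeIsoRows2_length : threeIsoRows2.length = 1570 := by
  simp only [threeIsoRows2, List.length_append, threeIsoRowsD_length, threeIsoRowsE_length, threeIsoRowsF_length, threeIsoRowsG_length, threeIsoRowsH_length, threeIsoRowsI_length, threeIsoRowsJ_length, threeIsoRowsK_length, threeIsoRowsL_length, threeIsoRowsM_length, threeIsoRowsN_length]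

/-- Every row of `threeIsoRows2` is a row of the census table `rank2Table`. [folklore] -/
theorem forall_mem_threeIsoRows2_mem_rank2Table : ∀ r ∈ threeIsoRows2, r ∈ rank2Table := by
  intro r hr
  simp only [threeIsoRows2, List.mem_append, or_assoc] at hr
  rcases hr with h | h | h | h | h | h | h | h | h | h | h
  · exact forall_mem_threeIsoRowsD_mem_rank2Table r h
  · exact forall_mem_threeIsoRowsE_mem_rank2Table r h
  · exact forall_mem_threeIsoRowsF_mem_rank2Table r h
  · exact forall_mem_threeIsoRowsG_mem_rank2Table r h
  · exact forall_mem_threeIsoRowsH_mem_rank2Table r h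
  · exact forall_mem_threeIsoRowsI_mem_rank2Table r h
  · exact forall_mem_threeIsoRowsJ_mem_rank2Table r h
  · exact forall_mem_threeIsoRowsK_mem_rank2Table r h
  · exact forall_mem_threeIsoRowsL_mem_rank2Table r h
  · exact forall_mem_threeIsoRowsM_mem_rank2Table r h
  · exact forall_mem_threeIsoRowsN_mem_rank2Table r h

/-- **THE KERNEL-3ISO CENSUS THEOREM, second part: `rank_ℤ E(ℚ) = 2` with NO hypothesis for every one of the 1570 rows of
`threeIsoRows2`** (`hup` by `3`-isogeny descent with certificate lists, `hlow` by kernel certificate).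
[cite: CremonaAlgorithms1997, Table 1] [cite: Cohen2007NumberTheoryI, Prop. 8.4.8] [cite: CohenPazuki2009, Prop. 2.2, Thm. 3.1, Thm. 4.1] -/
theorem forall_mem_threeIsoRows2_rank_eq_two : ∀ r ∈ threeIsoRows2, r.curve.mordellWeilRank = 2 := by
  intro r hr
  simp only [threeIsoRows2, List.mem_append, or_assoc] at hr
  rcases hr with h | h | h | h | h | h | h | h | h | h | h
  · exact forall_mem_threeIsoRowsD_rank_eq_two r h
  · exact forall_mem_threeIsoRowsE_rank_eq_two r h
  · exact forall_mem_threeIsoRowsF_rank_eq_two r h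
  · exact forall_mem_threeIsoRowsG_rank_eq_two r h
  · exact forall_mem_threeIsoRowsH_rank_eq_two r h
  · exact forall_mem_threeIsoRowsI_rank_eq_two r h
  · exact forall_mem_threeIsoRowsJ_rank_eq_two r h
  · exact forall_mem_threeIsoRowsK_rank_eq_two r h
  · exact forall_mem_threeIsoRowsL_rank_eq_two r h
  · exact forall_mem_threeIsoRowsM_rank_eq_two r h
  · exact forall_mem_threeIsoRowsN_rank_eq_two r h

/-- `L(E,1) = L′(E,1) = 0` EXACTLY for every row of `threeIsoRows2`, from `hGZK` alone. [cite: CremonaAlgorithms1997, §2.13] [cite: Darmon2004, Thm. 3.22] -/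
theorem forall_mem_threeIsoRows2_lvalue_lderiv_eq_zero (hGZK : rank_eq_analyticRank_of_analyticRank_le_one) :
    ∀ r ∈ threeIsoRows2, r.curve.entireLFunction 1 = 0 ∧ deriv r.curve.entireLFunction 1 = 0 :=
  fun r hr => lvalue_lderiv_eq_zero_of_mem_rank2Table (forall_mem_threeIsoRows2_mem_rank2Table r hr) hGZK

/-- **`r_an = rank_ℤ` and `r_an = 2` for every row of `threeIsoRows2`** given `hGZK` and the row's one remaining certificate
field `hL2 : L″(E,1) ≠ 0`. [cite: CremonaAlgorithms1997, §2.13] [cite: Darmon2004, Thm. 3.22] -/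
theorem forall_mem_threeIsoRows2_analyticRank_eq_rank (hGZK : rank_eq_analyticRank_of_analyticRank_le_one) :
    ∀ r ∈ threeIsoRows2, iteratedDeriv 2 r.curve.entireLFunction 1 ≠ 0 →
      r.curve.analyticRank = r.curve.mordellWeilRank ∧ r.curve.analyticRank = 2 :=
  fun r hr hL2 => analyticRank_eq_rank_of_mem_rank2Table (forall_mem_threeIsoRows2_mem_rank2Table r hr) hGZK
    (forall_mem_threeIsoRows2_rank_eq_two r hr).le hL2

end Summit.BirchSwinnertonDyer.BirchSwinnertonDyer.Rank2Observatory
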